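import Literature.Probability.RandomPlanarGeometry.HexSAWBrickWallSlabFugacityStrict
import Literature.Probability.RandomPlanarGeometry.HexSAWBrickWallSlabFugacityConvex
import Mathlib.Analysis.SpecificLimits.Basic
import HarnessLib

/-!
# Beaton 2014 Corollary 10 for the armchair slabs (the `Ĉ`-part): `Σ_n Ĉ_{H,n}(y,1) xⁿ` converges EXACTLY for `x < ρ_H(y) := μ_H(y,1)⁻¹`;
# the radius `ρ_H(y)` is strictly decreasing in the strip index (Prop. 9) and non-increasing in the fugacity (Prop. 8)

Topic `Literature/Probability/RandomPlanarGeometry` (lane «pcv-sawmu», rotated-door lineage, a-p6 g14; rider on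
`HexSAWBrickWallSlabFugacity.lean` — `HexBW.slabZ H n y = Ĉ_{H,n}(y,1)` over translation classes of the column slab `Slab_H`,
`HexBW.slabMuY H y = μ_H(y,1)`, `HexBW.tendsto_slabZ_rpow` (`Ĉ_{H,n}^{1/n} → μ_H`), `HexBW.pow_slabMuY_le` (`μ_Hⁿ ≤ max(1,y⁻¹) Ĉ_{H,n}`) —,
`HexSAWBrickWallSlabFugacityStrict.lean` (`HexBW.slabMuY_lt_succ`, Proposition 9 sentence 1) and `HexSAWBrickWallSlabFugacityConvex.lean`
(`HexBW.slabMuY_mono_y`)).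

Source.  N. R. Beaton, *The critical surface fugacity of self-avoiding walks on a rotated honeycomb lattice*, J. Phys. A 47 (2014)
075003, arXiv:1210.0274v3, §3.2, Corollary 10 (p. 15; held corpus text `paper:arxiv-1210.0274` chunk 11 ll. 47–60): "The final result
of this section concerns the properties of `ρ_T(y) := μ_T(1,y)⁻¹`, which is the radius of convergence of the generating function
`Ĉ_T(x,y) := Σ_{n≥0} Ĉ_{T,n}(1,y) xⁿ`, and of the similarly-defined functions `Â_T(x,y)` and `B̂_T(x,y)`.  Corollary 10. For `y > 0`, the
generating functions `Â_T(x,y)`, `B̂_T(x,y)` and `Ĉ_T(x,y)` all have the radius of convergence, `ρ_T(y) = μ_T(1,y)⁻¹` …" (the corollary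
continues "Moreover, `ρ_T(y)` decreases to `ρ(y) := μ(y)⁻¹` as `T → ∞`" and with the `y_T` sentences; treated here: the `Ĉ`-part, the monotonicity of
`ρ_T(y)` in `T` (from Proposition 9's `μ_T(1,y) < μ_{T+1}(1,y)`) and in `y` (Proposition 8's "non-decreasing in `y`", inverted — NOT a clause of Corollary 10) —
the arch/bridge generating functions `Â_T`, `B̂_T` of the strips are not objects of `HexSAWBrickWallSlabFugacity.lean`, and the limit
`ρ_T(y) → μ(y)⁻¹` is Proposition 9's convergence, see the one-car `HexSAWRotSurfaceArmRate.lean`).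

Frame.  `HexBW.slabMuY H y` is `μ_T(y,1)` for Beaton's strip realised as the column slab `Slab_H` of the brick wall with the weight on
the column `x₀ = 0` (translation classes, `H ≥ 1`); the printed `μ_T(1,y)` equals `μ_T(y,1)` by Proposition 8's symmetry (tree
`HexBW.slabMuY₂_symm`, not imported).  The radius statement is given in the elementary two-sided form (no `def` is introduced):
CONVERGENCE for `0 ≤ x` with `x · μ_H(y,1) < 1` and DIVERGENCE for `x · μ_H(y,1) ≥ 1` — divergence holds ON the circle as well, because
`Ĉ_{H,n}(y,1) xⁿ ≥ (x μ_H)ⁿ / max(1,y⁻¹) ≥ 1/max(1,y⁻¹)` does not tend to `0` (super-multiplicativity side of Fekete).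

## What is proved (namespace `Literature.Probability.RandomPlanarGeometry.SAW.HexBW`; `H ≥ 1`, `y > 0`)

* `eventually_slabZ_le_pow` — `μ_H(y,1) < r ⇒ Ĉ_{H,n}(y,1) ≤ rⁿ` eventually; `div_pow_le_slabZ` — `(μ_H)ⁿ / max(1,y⁻¹) ≤ Ĉ_{H,n}(y,1)` for all `n`;
* **`summable_slabZ_mul_pow`** — `x μ_H(y,1) < 1 ⇒ Σ_n Ĉ_{H,n}(y,1) xⁿ < ∞`; **`not_summable_slabZ_mul_pow`** — `1 ≤ x μ_H(y,1) ⇒` divergence;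
  **`summable_slabZ_mul_pow_iff`** — for `0 ≤ x`: `Summable ↔ x < μ_H(y,1)⁻¹` (Corollary 10, `Ĉ`-part: the radius IS `ρ_H(y) = μ_H(y,1)⁻¹`);
* `inv_slabMuY_succ_lt` — `ρ_{H+1}(y) < ρ_H(y)` (strictly decreasing in the strip index; Prop. 9 sentence 1),
  `inv_slabMuY_antitoneOn` — `y ↦ ρ_H(y)` is non-increasing on `(0,∞)` (Prop. 8 monotonicity).

LABEL (author's proposal): CONSOLIDATION AS PRINTED (XS) of Corollary 10's `Ĉ`-clause and its "decreases [in `T`]" clause, plus Proposition 8's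
fugacity monotonicity read on the radius; the device is the root test on the tree's Fekete limit — no new mathematics.
EDITION ed.2 (docstring-only; code identical to ed.1 `04b82bcb5b6b164f`): the attribution of the `y`-monotonicity corrected to Proposition 8
(referee ref g53 §91.7, 2026-08-24).
-/

noncomputable section

open Filter Finset
open _root_.Topology
open Literature.Probability.LatticeModels

namespace Literature.Probability.RandomPlanarGeometry.SAW.HexBW

variable {H : ℕ} {y x r : ℝ}

/-! ### The two sides of the root test -/

/-- **Inner side**: if `μ_H(y,1) < r` then `Ĉ_{H,n}(y,1) ≤ rⁿ` for all large `n` (`Ĉ_{H,n}^{1/n} → μ_H`).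
[cite: Beaton2014RotatedHoneycomb, §3.2, Proposition 8 and Corollary 10 (arXiv:1210.0274v3 p. 15)] -/
theorem eventually_slabZ_le_pow (hH : 1 ≤ H) (hy : 0 < y) (hr : slabMuY H y < r) :
    ∀ᶠ n : ℕ in atTop, slabZ H n y ≤ r ^ n := by
  have hr0 : 0 < r := (slabMuY_pos hH hy).trans hr
  filter_upwards [(tendsto_slabZ_rpow hH hy).eventually (gt_mem_nhds hr), eventually_ge_atTop 1] with n hn hn1
  have h0 : 0 ≤ slabZ H n y := (slabZ_pos hH n hy).le
  have hn0 : (n : ℝ) ≠ 0 := by exact_mod_cast (show n ≠ 0 by omega)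
  have h := pow_le_pow_left₀ (Real.rpow_nonneg h0 _) hn.le n
  rwa [one_div, Real.rpow_inv_natCast_pow h0 (by omega)] at h

/-- **Outer side, for ALL `n`**: `μ_H(y,1)ⁿ / max(1,y⁻¹) ≤ Ĉ_{H,n}(y,1)` (the super-multiplicative half of Fekete, tree `pow_slabMuY_le`).
[cite: Beaton2014RotatedHoneycomb, §3.2, Proposition 8 (arXiv:1210.0274v3 p. 15); MadrasSlade1993, Lemma 1.2.2 (p. 9)] -/
theorem div_pow_le_slabZ (hH : 1 ≤ H) (hy : 0 < y) (n : ℕ) : slabMuY H y ^ n / yK y ≤ slabZ H n y := by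
  have hK : 0 < yK y := lt_of_lt_of_le one_pos (one_le_yK y)
  rw [div_le_iff₀ hK, mul_comm]
  exact pow_slabMuY_le hH n hy (slabMuY_pos hH hy).le

/-! ### Corollary 10, `Ĉ`-part: the radius of `Σ_n Ĉ_{H,n}(y,1) xⁿ` is `μ_H(y,1)⁻¹` -/

/-- **Convergence inside the radius**: `0 ≤ x`, `x · μ_H(y,1) < 1 ⇒ Σ_n Ĉ_{H,n}(y,1) xⁿ < ∞`.
[cite: Beaton2014RotatedHoneycomb, §3.2, Corollary 10 (arXiv:1210.0274v3 p. 15: "ρ_T(y) = μ_T(1,y)⁻¹ … is the radius of convergence of … Ĉ_T(x,y)")] -/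
theorem summable_slabZ_mul_pow (hH : 1 ≤ H) (hy : 0 < y) (hx : 0 ≤ x) (h : x * slabMuY H y < 1) :
    Summable fun n : ℕ => slabZ H n y * x ^ n := by
  rcases hx.eq_or_lt with rfl | hx0
  · refine summable_of_ne_finset_zero (s := {0}) fun n hn => ?_
    rw [Finset.mem_singleton] at hn
    simp [zero_pow hn]
  obtain ⟨q, hq1, hq2⟩ := exists_between h
  have hq0 : 0 < q := (mul_pos hx0 (slabMuY_pos hH hy)).trans hq1
  have hμr : slabMuY H y < q / x := by rwa [lt_div_iff₀ hx0, mul_comm]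
  refine Summable.of_norm_bounded_eventually_nat (summable_geometric_of_lt_one hq0.le hq2) ?_
  filter_upwards [eventually_slabZ_le_pow hH hy hμr] with n hn
  rw [Real.norm_of_nonneg (mul_nonneg (slabZ_pos hH n hy).le (pow_nonneg hx n))]
  calc slabZ H n y * x ^ n ≤ (q / x) ^ n * x ^ n := mul_le_mul_of_nonneg_right hn (pow_nonneg hx n)
    _ = q ^ n := by rw [← mul_pow, div_mul_cancel₀ q hx0.ne']

/-- **Divergence on and outside the radius**: `1 ≤ x · μ_H(y,1) ⇒ Σ_n Ĉ_{H,n}(y,1) xⁿ = ∞` — the terms are `≥ 1/max(1,y⁻¹)`, so they do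
not tend to `0` (this includes the circle `x = ρ_H(y)` itself). [cite: Beaton2014RotatedHoneycomb, §3.2, Corollary 10 (arXiv:1210.0274v3 p. 15)] -/
theorem not_summable_slabZ_mul_pow (hH : 1 ≤ H) (hy : 0 < y) (hx : 0 ≤ x) (h : 1 ≤ x * slabMuY H y) :
    ¬ Summable fun n : ℕ => slabZ H n y * x ^ n := by
  intro hs
  have hK : 0 < yK y := lt_of_lt_of_le one_pos (one_le_yK y)
  have h1 : ∀ n : ℕ, (yK y)⁻¹ ≤ slabZ H n y * x ^ n := fun n => by
    calc (yK y)⁻¹ = 1 / yK y := (one_div _).symm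
      _ ≤ (x * slabMuY H y) ^ n / yK y := div_le_div_of_nonneg_right (one_le_pow₀ h) hK.le
      _ = slabMuY H y ^ n / yK y * x ^ n := by rw [mul_pow]; ring
      _ ≤ slabZ H n y * x ^ n := mul_le_mul_of_nonneg_right (div_pow_le_slabZ hH hy n) (pow_nonneg hx n)
  have h2 : ∀ᶠ n : ℕ in atTop, slabZ H n y * x ^ n < (yK y)⁻¹ :=
    hs.tendsto_atTop_zero.eventually (gt_mem_nhds (inv_pos.2 hK))
  obtain ⟨n, hn⟩ := h2.exists
  exact absurd hn (not_lt.2 (h1 n))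

/-- **Corollary 10 (`Ĉ`-part) for the armchair slabs: the radius of convergence of `Σ_n Ĉ_{H,n}(y,1) xⁿ` IS `ρ_H(y) = μ_H(y,1)⁻¹`** —
for `0 ≤ x`, the series converges iff `x < μ_H(y,1)⁻¹`.
[cite: Beaton2014RotatedHoneycomb, §3.2, Corollary 10 (arXiv:1210.0274v3 p. 15: "all have the radius of convergence, ρ_T(y) = μ_T(1,y)⁻¹")] -/
theorem summable_slabZ_mul_pow_iff (hH : 1 ≤ H) (hy : 0 < y) (hx : 0 ≤ x) :
    (Summable fun n : ℕ => slabZ H n y * x ^ n) ↔ x < (slabMuY H y)⁻¹ := by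
  have hμ := slabMuY_pos hH hy
  constructor
  · intro hs
    by_contra hle
    rw [not_lt] at hle
    have h1 : 1 ≤ x * slabMuY H y := by
      calc (1 : ℝ) = (slabMuY H y)⁻¹ * slabMuY H y := by rw [inv_mul_cancel₀ hμ.ne']
        _ ≤ x * slabMuY H y := mul_le_mul_of_nonneg_right hle hμ.le
    exact not_summable_slabZ_mul_pow hH hy hx h1 hs
  · intro hlt
    refine summable_slabZ_mul_pow hH hy hx ?_
    calc x * slabMuY H y < (slabMuY H y)⁻¹ * slabMuY H y := mul_lt_mul_of_pos_right hlt hμ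
      _ = 1 := inv_mul_cancel₀ hμ.ne'

/-! ### Corollary 10, monotonicity clauses: `ρ_H(y)` decreases strictly in the strip index and weakly in the fugacity -/

/-- **`ρ_{H+1}(y) < ρ_H(y)`**: the radius decreases STRICTLY with the strip index (`H ≥ 1`, `y > 0`; Proposition 9's
`μ_T(1,y) < μ_{T+1}(1,y)`). [cite: Beaton2014RotatedHoneycomb, §3.2, Proposition 9 and Corollary 10 (arXiv:1210.0274v3 p. 15)] -/
theorem inv_slabMuY_succ_lt (hH : 1 ≤ H) (hy : 0 < y) : (slabMuY (H + 1) y)⁻¹ < (slabMuY H y)⁻¹ :=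
  inv_strictAnti₀ (slabMuY_pos hH hy) (slabMuY_lt_succ hH hy)

/-- **`y ↦ ρ_H(y)` is non-increasing on `(0, ∞)`** (`H ≥ 1`; Proposition 8's monotonicity in the fugacity).
[cite: Beaton2014RotatedHoneycomb, §3.2, Proposition 8 and Corollary 10 (arXiv:1210.0274v3 p. 15)] -/
theorem inv_slabMuY_antitoneOn (hH : 1 ≤ H) : AntitoneOn (fun y : ℝ => (slabMuY H y)⁻¹) (Set.Ioi 0) :=
  fun _ hy _ _ hyy' => inv_anti₀ (slabMuY_pos hH hy) (slabMuY_mono_y hH hy hyy')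

/-- **The radius lies in `(0, 1]` for `H ≥ 2`** (`μ_H(y,1) ≥ 1` there, tree `one_le_slabMuY`), and is positive for every `H ≥ 1`.
[cite: Beaton2014RotatedHoneycomb, §3.2, Corollary 10 (arXiv:1210.0274v3 p. 15)] -/
theorem inv_slabMuY_pos_le_one (hH : 2 ≤ H) (hy : 0 < y) : 0 < (slabMuY H y)⁻¹ ∧ (slabMuY H y)⁻¹ ≤ 1 :=
  ⟨inv_pos.2 (slabMuY_pos (by omega) hy), inv_le_one_of_one_le₀ (one_le_slabMuY hH hy)⟩

end Literature.Probability.RandomPlanarGeometry.SAW.HexBW
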